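import Summits.RiemannHypothesis.RiemannHypothesis.Theorems.ZetaStringArchWallDefs
import HarnessLib

/-!
# Kreĭn kernels of even functions: symmetric window `(−a, a)` ⟺ one-sided window `(0, 2a)` (column DBR; RH-FREE bookkeeping)

LINE 1 — LABEL: RH-FREE, purely structural (finite sums; no property of `ζ` is used beyond `Ψ(−t) = Ψ(t)`, `Ψ(0) = 0`).
bears_on: LADDER-RH B-D → B-P(P1) (cell rh-dbr: the dictionary «one-sided window ℓ = 2a ↔ symmetric half-width a» of
ENGINE-TARGETS §3.1, used by ET6 / `ArchWallHolds` / PluckedString's `ArchWallDepth` a_∞*). Nothing here bears on RH.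

For an EVEN function `f : ℝ → ℝ` with `f 0 = 0`, the Kreĭn kernel `K_f(t,u) = f(t) + f(u) − f(t − u)` is positive semidefinite on
finite configurations in `(−a, a)` iff it is on configurations in `(0, 2a)`: both say that `f` is conditionally negative definite on
zero-sum configurations of diameter `< 2a` (augment by the node `0`, where `K_f` vanishes, and translate). Applied to `Ψ = zetaScrew`
and to the archimedean wall `Ψ_∅ = archScrew`:
* `krein_psd_Ioo_symm_iff` (generic), `isPosSemidefKernelOn_zetaScrewKernel_symm_iff`,
* `archWallHolds_iff_symm : ArchWallHolds ℓ ↔ IsPosSemidefKernelOn archKernel (Ioo (−ℓ/2) (ℓ/2))` — so `ArchWallHolds ℓ` is literally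
  «`a = ℓ/2` is below PluckedString's `a_∞*`».
-/

-- `Summit.RiemannHypothesis.RiemannHypothesis.…` duplicates `RiemannHypothesis` BY DESIGN (D-0017).
set_option linter.dupNamespace false

noncomputable section

open scoped BigOperators ComplexConjugate ComplexOrder

namespace Summit.RiemannHypothesis.RiemannHypothesis.Theorems.ZetaStringArchWall

open Literature.NumberTheory.LFunctions Literature.Analysis.Complex

/-! ## §1 Generic Kreĭn kernels of even functions -/

/-- The Kreĭn kernel `K_f(t,u) = f(t) + f(u) − f(t − u)` of a real function, as a complex kernel. -/
def kreinKernel (f : ℝ → ℝ) (t u : ℝ) : ℂ := ((f t + f u - f (t - u) : ℝ) : ℂ)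

/-- Real/complex bridge for the Kreĭn kernel of an even function (real symmetric kernel): PSD on `S` iff all REAL
quadratic forms over configurations in `S` are non-negative. [folklore] -/
theorem krein_psd_iff_real {f : ℝ → ℝ} (hf : ∀ t, f (-t) = f t) (S : Set ℝ) :
    IsPosSemidefKernelOn (kreinKernel f) S ↔
      ∀ (N : ℕ) (t x : Fin N → ℝ), (∀ i, t i ∈ S) →
        0 ≤ ∑ i, ∑ j, (f (t i) + f (t j) - f (t i - t j)) * (x i * x j) := by
  have hsymm : ∀ t u : ℝ, f t + f u - f (t - u) = f u + f t - f (u - t) := by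
    intro t u; rw [← hf (t - u), neg_sub]; ring
  constructor
  · intro h N t x ht
    have h1 : 0 ≤ ∑ i, ∑ j, conj (x i : ℂ) * (x j : ℂ) * kreinKernel f (t i) (t j) :=
      h N t ht (fun i => (x i : ℂ))
    have h2 : ∑ i, ∑ j, conj (x i : ℂ) * (x j : ℂ) * kreinKernel f (t i) (t j)
        = ((∑ i, ∑ j, (f (t i) + f (t j) - f (t i - t j)) * (x i * x j) : ℝ) : ℂ) := by
      push_cast
      refine Finset.sum_congr rfl fun i _ => Finset.sum_congr rfl fun j _ => ?_
      rw [Complex.conj_ofReal, kreinKernel]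
      push_cast
      ring
    rw [h2, Complex.zero_le_real] at h1
    exact h1
  · intro h N t ht c
    show 0 ≤ ∑ i, ∑ j, conj (c i) * c j * kreinKernel f (t i) (t j)
    simp only [kreinKernel]
    rw [sum_sum_conj_mul_mul_ofReal Finset.univ (fun i j => f (t i) + f (t j) - f (t i - t j))
      (fun i j => hsymm _ _) c, Complex.zero_le_real]
    exact add_nonneg (h N t (fun i => (c i).re) ht) (h N t (fun i => (c i).im) ht)

/-- Zero-sum reduction: for weights with `Σ wᵢ = 0` the Kreĭn form is `−Σ wᵢwⱼ f(sᵢ − sⱼ)`. [folklore] -/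
theorem krein_sum_eq_neg_of_sum_eq_zero (f : ℝ → ℝ) {N : ℕ} (s w : Fin N → ℝ) (hw : ∑ i, w i = 0) :
    ∑ i, ∑ j, (f (s i) + f (s j) - f (s i - s j)) * (w i * w j) =
      -∑ i, ∑ j, w i * w j * f (s i - s j) := by
  have e : ∀ i j, (f (s i) + f (s j) - f (s i - s j)) * (w i * w j) =
      w i * w j * f (s i) + w i * w j * f (s j) - w i * w j * f (s i - s j) := by
    intro i j; ring
  have h1 : ∑ i, ∑ j, w i * w j * f (s i) = 0 := by
    have : ∀ i, ∑ j, w i * w j * f (s i) = w i * f (s i) * ∑ j, w j := fun i => by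
      rw [Finset.mul_sum]; exact Finset.sum_congr rfl fun j _ => by ring
    simp_rw [this, hw, mul_zero, Finset.sum_const_zero]
  have h2 : ∑ i, ∑ j, w i * w j * f (s j) = 0 := by
    rw [Finset.sum_comm]
    have : ∀ j, ∑ i, w i * w j * f (s j) = w j * f (s j) * ∑ i, w i := fun j => by
      rw [Finset.mul_sum]; exact Finset.sum_congr rfl fun i _ => by ring
    simp_rw [this, hw, mul_zero, Finset.sum_const_zero]
  simp only [e, Finset.sum_add_distrib, Finset.sum_sub_distrib, h1, h2]
  ring

/-- Augmentation: the Kreĭn form over `t₁..t_N` equals the form over the zero-sum system `(0, t₁, .., t_N)` with weights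
`(−Σ xᵢ, x₁, .., x_N)` (uses `f 0 = 0`, `f` even). [folklore] -/
theorem krein_sum_eq_cons {f : ℝ → ℝ} (hf : ∀ t, f (-t) = f t) (hf0 : f 0 = 0) {N : ℕ} (t x : Fin N → ℝ) :
    ∑ i, ∑ j, (f (t i) + f (t j) - f (t i - t j)) * (x i * x j) =
      ∑ i : Fin (N + 1), ∑ j : Fin (N + 1),
        (f ((Fin.cons 0 t : Fin (N + 1) → ℝ) i) + f ((Fin.cons 0 t : Fin (N + 1) → ℝ) j)
          - f ((Fin.cons 0 t : Fin (N + 1) → ℝ) i - (Fin.cons 0 t : Fin (N + 1) → ℝ) j))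
          * ((Fin.cons (-∑ i, x i) x : Fin (N + 1) → ℝ) i * (Fin.cons (-∑ i, x i) x : Fin (N + 1) → ℝ) j) := by
  simp only [Fin.sum_univ_succ, Fin.cons_zero, Fin.cons_succ, hf0, zero_add, zero_sub, hf, sub_zero, sub_self,
    add_zero, zero_mul, Finset.sum_const_zero]

/-- Translation invariance of the zero-sum form. [folklore] -/
theorem sum_sum_shift (f : ℝ → ℝ) {N : ℕ} (s w : Fin N → ℝ) (c : ℝ) :
    ∑ i, ∑ j, w i * w j * f ((s i - c) - (s j - c)) = ∑ i, ∑ j, w i * w j * f (s i - s j) := by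
  refine Finset.sum_congr rfl fun i _ => Finset.sum_congr rfl fun j _ => ?_
  rw [sub_sub_sub_cancel_right]

/-- **Symmetric ⟹ one-sided window.** [folklore] -/
theorem krein_psd_Ioo_zero_of_symm {f : ℝ → ℝ} (hf : ∀ t, f (-t) = f t) (hf0 : f 0 = 0) {a : ℝ}
    (h : IsPosSemidefKernelOn (kreinKernel f) (Set.Ioo (-a) a)) :
    IsPosSemidefKernelOn (kreinKernel f) (Set.Ioo 0 (2 * a)) := by
  rw [krein_psd_iff_real hf] at h ⊢
  intro N t x ht
  rcases Nat.eq_zero_or_pos N with hN | hN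
  · subst hN; simp
  set s : Fin (N + 1) → ℝ := Fin.cons 0 t with hsdef
  set w : Fin (N + 1) → ℝ := Fin.cons (-∑ i, x i) x with hwdef
  have hs0 : ∀ i, 0 ≤ s i := fun i => by
    refine Fin.cases ?_ (fun i => ?_) i
    · simp [hsdef]
    · simpa [hsdef] using (ht i).1.le
  have hs2 : ∀ i, s i < 2 * a := fun i => by
    refine Fin.cases ?_ (fun i => ?_) i
    · have h0 := ht ⟨0, hN⟩
      simp only [hsdef, Fin.cons_zero]
      exact h0.1.trans h0.2
    · simpa [hsdef] using (ht i).2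
  have hw : ∑ i, w i = 0 := by simp [hwdef, Fin.sum_univ_succ]
  have hne : (Finset.univ : Finset (Fin (N + 1))).Nonempty := Finset.univ_nonempty
  obtain ⟨iM, -, hiM⟩ := Finset.exists_mem_eq_sup' hne s
  obtain ⟨im, -, him⟩ := Finset.exists_mem_eq_inf' hne s
  set c : ℝ := (Finset.univ.sup' hne s + Finset.univ.inf' hne s) / 2 with hcdef
  have hs' : ∀ i, s i - c ∈ Set.Ioo (-a) a := by
    intro i
    have h1 : s i ≤ Finset.univ.sup' hne s := Finset.le_sup' s (Finset.mem_univ i)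
    have h2 : Finset.univ.inf' hne s ≤ s i := Finset.inf'_le s (Finset.mem_univ i)
    have h3 := hs2 iM
    have h4 := hs0 im
    rw [← hiM] at h3
    rw [← him] at h4
    constructor <;> linarith
  have key := h (N + 1) (fun i => s i - c) w hs'
  rw [krein_sum_eq_neg_of_sum_eq_zero f _ w hw, sum_sum_shift] at key
  rw [krein_sum_eq_cons hf hf0 t x, krein_sum_eq_neg_of_sum_eq_zero f s w hw]
  exact key

/-- **One-sided ⟹ symmetric window.** [folklore] -/
theorem krein_psd_symm_of_Ioo_zero {f : ℝ → ℝ} (hf : ∀ t, f (-t) = f t) (hf0 : f 0 = 0) {a : ℝ}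
    (h : IsPosSemidefKernelOn (kreinKernel f) (Set.Ioo 0 (2 * a))) :
    IsPosSemidefKernelOn (kreinKernel f) (Set.Ioo (-a) a) := by
  rw [krein_psd_iff_real hf] at h ⊢
  intro N t x ht
  rcases Nat.eq_zero_or_pos N with hN | hN
  · subst hN; simp
  set s : Fin (N + 1) → ℝ := Fin.cons 0 t with hsdef
  set w : Fin (N + 1) → ℝ := Fin.cons (-∑ i, x i) x with hwdef
  have hs : ∀ i, s i ∈ Set.Ioo (-a) a := fun i => by
    refine Fin.cases ?_ (fun i => ?_) i
    · have h0 := ht ⟨0, hN⟩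
      simp only [hsdef, Fin.cons_zero, Set.mem_Ioo]
      constructor <;> linarith [h0.1, h0.2]
    · simpa [hsdef] using ht i
  have hw : ∑ i, w i = 0 := by simp [hwdef, Fin.sum_univ_succ]
  have hne : (Finset.univ : Finset (Fin (N + 1))).Nonempty := Finset.univ_nonempty
  obtain ⟨iM, -, hiM⟩ := Finset.exists_mem_eq_sup' hne s
  obtain ⟨im, -, him⟩ := Finset.exists_mem_eq_inf' hne s
  -- shift so that every node lies in `(0, 2a)`: subtract `inf − η` with `0 < η < 2a − (sup − inf)`
  set η : ℝ := (2 * a - (Finset.univ.sup' hne s - Finset.univ.inf' hne s)) / 2 with hηdef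
  have hη : 0 < η := by
    have h3 := hs iM
    have h4 := hs im
    rw [← hiM] at h3
    rw [← him] at h4
    rw [hηdef]
    linarith [h3.2, h4.1]
  set c : ℝ := Finset.univ.inf' hne s - η with hcdef
  have hs' : ∀ i, s i - c ∈ Set.Ioo 0 (2 * a) := by
    intro i
    have h1 : s i ≤ Finset.univ.sup' hne s := Finset.le_sup' s (Finset.mem_univ i)
    have h2 : Finset.univ.inf' hne s ≤ s i := Finset.inf'_le s (Finset.mem_univ i)
    have h3 := hs iM
    have h4 := hs im
    rw [← hiM] at h3
    rw [← him] at h4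
    constructor <;> [skip; skip] <;> linarith [h3.2, h4.1]
  have key := h (N + 1) (fun i => s i - c) w hs'
  rw [krein_sum_eq_neg_of_sum_eq_zero f _ w hw, sum_sum_shift] at key
  rw [krein_sum_eq_cons hf hf0 t x, krein_sum_eq_neg_of_sum_eq_zero f s w hw]
  exact key

/-- **The window dictionary for Kreĭn kernels of even functions**: PSD on `(−a, a)` iff PSD on `(0, 2a)`. [folklore] -/
theorem krein_psd_symm_iff {f : ℝ → ℝ} (hf : ∀ t, f (-t) = f t) (hf0 : f 0 = 0) (a : ℝ) :
    IsPosSemidefKernelOn (kreinKernel f) (Set.Ioo (-a) a) ↔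
      IsPosSemidefKernelOn (kreinKernel f) (Set.Ioo 0 (2 * a)) :=
  ⟨krein_psd_Ioo_zero_of_symm hf hf0, krein_psd_symm_of_Ioo_zero hf hf0⟩

/-! ## §2 Specialisations: `Ψ` and the archimedean wall `Ψ_∅` -/

/-- `zetaScrewKernel` is the Kreĭn kernel of `Ψ`. -/
theorem kreinKernel_zetaScrew : kreinKernel zetaScrew = fun t u => (zetaScrewKernel t u : ℂ) := by
  funext t u; rfl

/-- `archKernel` is the Kreĭn kernel of `Ψ_∅`. -/
theorem kreinKernel_archScrew : kreinKernel archScrew = archKernel := by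
  funext t u; rfl

/-- RH-FREE bookkeeping for Suzuki's kernel: PSD on `(−a, a)` iff PSD on `(0, 2a)`. [folklore] -/
theorem isPosSemidefKernelOn_zetaScrewKernel_symm_iff (a : ℝ) :
    IsPosSemidefKernelOn (fun t u : ℝ => (zetaScrewKernel t u : ℂ)) (Set.Ioo (-a) a) ↔
      IsPosSemidefKernelOn (fun t u : ℝ => (zetaScrewKernel t u : ℂ)) (Set.Ioo 0 (2 * a)) := by
  rw [← kreinKernel_zetaScrew]
  exact krein_psd_symm_iff zetaScrew_neg zetaScrew_zero a

/-- RH-FREE bookkeeping for the wall: `ArchWallHolds ℓ` iff the archimedean kernel is PSD on the symmetric window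
`(−ℓ/2, ℓ/2)` — i.e. iff `ℓ/2` lies below PluckedString's `a_∞*` (`ArchWallDepth`, stmt-2758, symmetric normalisation). [folklore] -/
theorem archWallHolds_iff_symm (l : ℝ) :
    ArchWallHolds l ↔ IsPosSemidefKernelOn archKernel (Set.Ioo (-(l / 2)) (l / 2)) := by
  unfold ArchWallHolds
  rw [← kreinKernel_archScrew, krein_psd_symm_iff archScrew_neg archScrew_zero (l / 2)]
  rw [show 2 * (l / 2) = l by ring]

/-- The same for the negative statement: `ArchWallTies ℓ̄` iff the archimedean kernel is NOT PSD on `(−ℓ̄/2, ℓ̄/2)`. [folklore] -/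
theorem archWallTies_iff_symm (l : ℝ) :
    ArchWallTies l ↔ ¬ IsPosSemidefKernelOn archKernel (Set.Ioo (-(l / 2)) (l / 2)) := by
  unfold ArchWallTies
  rw [← (archWallHolds_iff_symm l)]
  rfl

end Summit.RiemannHypothesis.RiemannHypothesis.Theorems.ZetaStringArchWall

end
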